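import Summits.HodgeConjecture.HodgeConjecture.Theorems.F0P3cStCharTSWeylHypJacobianSocket   -- ★/⏳ p852119 (this seat) (J6) FILE 6 «SOCKET» `tubeJacobianSocket_vanDijkWeight_sq`; brings ★ «ADAPTER-M» p851891
import HarnessLib

/-!
# F0 · P3c · line LH6 «StCharTS» — ROAD «JAC-LOC» brick (J6) FILE 7 «CARTAN SLOT M»: ★ p851803's local tube-Jacobian socket AT THE SPLIT CARTAN `T = M` with the
# weight `(Re Δ)² = D_G²`, UNCONDITIONALLY — on the matrix carrier and on `Gqs L v` (= ★ «ADAPTER-M» p851891 with its `hJacLoc` discharged by ★ FILE 6) (Harish-Chandra 1970 L. 22)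

Cell `pub/hodgecm-mathlib`, crux H413 = `stmt-HodgeConjecture-24833` (lane `--supports`, helper); seat LH6-p04 (g6).  THEOREMS ONLY; sorry-free; ★-only imports; no definition ∕
instance ∕ notation; the only hypothesis about the weight is the identity `hDM` (and the bookkeeping `hTM`, `hTcl`, `hΦ`, `htm`, `hw`, `hDD` of ★ p851891, verbatim); axioms
TRIO.  HONEST LABEL: count-neutral, closes no organ by itself — it is the `hJac i` INPUT of (E4) `weylIntegrationFormula_of_pins_of_tubeJacobians` at the split Cartan
`T i = M`; HC_CM is proved only modulo the 7 printed citations (2 remaining: hLiu418 = `stmt-HodgeConjecture-24832`, h413 = `stmt-HodgeConjecture-24833`) until rung 0 closes.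

WHAT.  Binders exactly as ★ p851891 `tubeJacobianLocal_cartan_of_cmTorus` ∕ `tubeJacobianLocal_cartan_Gqs_of_cmTorus` minus `hJacLoc`, plus `hns` (non-split `v`) and
`hDM : (DM t : ℝ) = (Re Δ(t))²`; conclusions VERBATIM (★ p851803's socket at `T`, `W`-free clause `∀ n ∉ T`, abstract `Φ`, given `tm`).
* **`tubeJacobianLocal_cartan_vanDijkWeight_sq`** — matrix carrier `↥(unitaryGroupOfForm (conjLocal L c v) (cmLocalForm L 3 v))`.
* **`tubeJacobianLocal_cartan_Gqs_vanDijkWeight_sq`** — organ carrier `Gqs L v` (instances passed by position to ★ FILE 6, as ★ p851891 §2 does).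
PROOF: ★ p851891 ∘ ★ FILE 6 `tubeJacobianSocket_vanDijkWeight_sq` (∘ ★ FILE 5 p852079 ∘ ★ FILE 4 p852061 ∘ ★ (T4) p852043 ∘ ★ (J6-M) ∕ (J6-W) ∕ (J6-D) ∕ (J6-T) ∕ (J1) ∘ ★ p851645).

## References
* [HarishChandra1970] Harish-Chandra, *Harmonic analysis on reductive p-adic groups*, LNM 162 (1970), Lemma 20, Lemma 22.
* [Rogawski1990] J. D. Rogawski, *Automorphic Representations of Unitary Groups in Three Variables*, Ann. of Math. Stud. 123 (1990), §12.5 p. 182; §3.6 p. 29.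
* [vanDijk1972] G. van Dijk, *Computation of certain induced characters of p-adic groups*, Math. Ann. 199 (1972), §2.
-/

set_option autoImplicit false
set_option linter.dupNamespace false

noncomputable section

open MeasureTheory Measure Set Filter Topology Function NumberField IsDedekindDomain Matrix
open Literature.MeasureTheory.Group
open Literature.NumberTheory.Automorphic Literature.NumberTheory.Automorphic.UnitaryGroup Literature.NumberTheory.Rogawski1990
open Summit.HodgeConjecture.HodgeConjecture.Cruxes.H413
open Summit.HodgeConjecture.HodgeConjecture.Cruxes.H413.F0P3cStCharTSWeylHypMeasure
open Summit.HodgeConjecture.HodgeConjecture.Cruxes.H413.F0P3cStCharTSWeylHypCM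
open Summit.HodgeConjecture.HodgeConjecture.Cruxes.H413.F0P3cStCharTSWeylHypTorsor
open Summit.HodgeConjecture.HodgeConjecture.Cruxes.H413.F0P3cStCharTSWeylHypSocketAdapter
open Summit.HodgeConjecture.HodgeConjecture.Cruxes.H413.F0P3cStCharTSWeylHypJacobianSocket
open scoped ENNReal NNReal MatrixGroups Pointwise

namespace Summit.HodgeConjecture.HodgeConjecture.Cruxes.H413.F0P3cStCharTSWeylHypJacobianCartanM

variable (L : Type) [Field L] [NumberField L] [IsCMField L] (v : HeightOneSpectrum (𝓞 ↥(maximalRealSubfield L)))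

/-! ## §1 On the matrix carrier `U(Φ₃)(L⁺_v)` -/

set_option maxHeartbeats 800000 in
set_option synthInstance.maxHeartbeats 400000 in
-- long socket statements (as in ★ p851891)
/-- **(J6) «CARTAN SLOT M» (matrix carrier).**  `T` a subgroup EQUAL to the split torus `M` (`hTM`), closed, any Borel structure on `G ⧸ T`, a conjugation map `Φ`,
a Haar measure `tm` of `T` with inversion symmetry and `tm (compactCore T) = 1`, `w` the Weyl representative, weights `D` on `T` and `DM` on `M` that agree (`hDD`) with
`(DM t : ℝ) = (Re Δ(t))²` (`hDM`), `v` non-split (`hns`): every regular `t₀ ∈ T` has an open `U ∋ t₀` and a measurable `A₀ ⊆ G ⧸ T` with `μ₀(A₀) ∈ (0, ∞)` such that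
`ν (Φ '' (A₀ ×ˢ V)) = μ₀(A₀) · ∫⁻_V D dtm` for all measurable regular `W`-free `V ⊆ U` — ★ p851891 §1 with `hJacLoc` := ★ FILE 6.
[cite: HarishChandra1970, Lemma 20; Lemma 22] [cite: Rogawski1990, §12.5 p. 182; §3.6 p. 29] [cite: vanDijk1972, §2] -/
theorem tubeJacobianLocal_cartan_vanDijkWeight_sq
    (hns : ∀ w : PlacesOver L v, IsCMField.complexConj L • w.1 = w.1)
    [MeasurableSpace ↥(unitaryGroupOfForm (conjLocal L (IsCMField.complexConj L) v) (cmLocalForm L 3 v))] [BorelSpace ↥(unitaryGroupOfForm (conjLocal L (IsCMField.complexConj L) v) (cmLocalForm L 3 v))] [LocallyCompactSpace ↥(unitaryGroupOfForm (conjLocal L (IsCMField.complexConj L) v) (cmLocalForm L 3 v))] [SecondCountableTopology ↥(unitaryGroupOfForm (conjLocal L (IsCMField.complexConj L) v) (cmLocalForm L 3 v))] [T2Space ↥(unitaryGroupOfForm (conjLocal L (IsCMField.complexConj L) v) (cmLocalForm L 3 v))]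
    (ν : Measure ↥(unitaryGroupOfForm (conjLocal L (IsCMField.complexConj L) v) (cmLocalForm L 3 v))) [ν.IsHaarMeasure] [ν.IsMulRightInvariant]
    {T : Subgroup ↥(unitaryGroupOfForm (conjLocal L (IsCMField.complexConj L) v) (cmLocalForm L 3 v))} (hTM : T = (cmBorelTriple L 3 v).M) (hTcl : IsClosed (T : Set ↥(unitaryGroupOfForm (conjLocal L (IsCMField.complexConj L) v) (cmLocalForm L 3 v))))
    [MeasurableSpace (↥(unitaryGroupOfForm (conjLocal L (IsCMField.complexConj L) v) (cmLocalForm L 3 v)) ⧸ T)] [BorelSpace (↥(unitaryGroupOfForm (conjLocal L (IsCMField.complexConj L) v) (cmLocalForm L 3 v)) ⧸ T)]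
    (Φ : (↥(unitaryGroupOfForm (conjLocal L (IsCMField.complexConj L) v) (cmLocalForm L 3 v)) ⧸ T) × ↥T → ↥(unitaryGroupOfForm (conjLocal L (IsCMField.complexConj L) v) (cmLocalForm L 3 v))) (hΦ : ∀ (x : ↥(unitaryGroupOfForm (conjLocal L (IsCMField.complexConj L) v) (cmLocalForm L 3 v))) (t : ↥T), Φ (QuotientGroup.mk x, t) = x * t * x⁻¹)
    (tm : Measure ↥T) [tm.IsHaarMeasure] [tm.IsInvInvariant] (htm : tm (compactCore ↥T) = 1)
    (w : ↥(unitaryGroupOfForm (conjLocal L (IsCMField.complexConj L) v) (cmLocalForm L 3 v))) (hw : Units.val (w : GL (Fin 3) (LocalRing L v)) = cmLocalForm L 3 v)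
    (DM : ↥(cmBorelTriple L 3 v).M → ℝ≥0) (D : ↥T → ℝ≥0) (hDD : ∀ (t : ↥T) (t' : ↥(cmBorelTriple L 3 v).M), (t : ↥(unitaryGroupOfForm (conjLocal L (IsCMField.complexConj L) v) (cmLocalForm L 3 v))) = (t' : ↥(unitaryGroupOfForm (conjLocal L (IsCMField.complexConj L) v) (cmLocalForm L 3 v))) → D t = DM t')
    (hDM : ∀ t : ↥(cmBorelTriple L 3 v).M, (DM t : ℝ) = ((F0P3cStCharTSTorusDefs.vanDijkWeight L v t).re) ^ 2) :
    ∀ t₀ : ↥T, IsRegularElt (((t₀ : ↥(unitaryGroupOfForm (conjLocal L (IsCMField.complexConj L) v) (cmLocalForm L 3 v)))) : GL (Fin 3) (LocalRing L v)) →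
      ∃ U : Set ↥T, IsOpen U ∧ t₀ ∈ U ∧
        ∃ A₀ : Set (↥(unitaryGroupOfForm (conjLocal L (IsCMField.complexConj L) v) (cmLocalForm L 3 v)) ⧸ T), MeasurableSet A₀ ∧ (quotientMeasure T tm hTcl ν) A₀ ≠ 0 ∧
          (quotientMeasure T tm hTcl ν) A₀ ≠ ∞ ∧
          ∀ V : Set ↥T, MeasurableSet V → V ⊆ U → (∀ t ∈ V, IsRegularElt (((t : ↥(unitaryGroupOfForm (conjLocal L (IsCMField.complexConj L) v) (cmLocalForm L 3 v)))) : GL (Fin 3) (LocalRing L v))) →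
            (∀ n : ↥(unitaryGroupOfForm (conjLocal L (IsCMField.complexConj L) v) (cmLocalForm L 3 v)), n ∉ T → ∀ t ∈ V, ∀ t' ∈ V, ((t' : ↥T) : ↥(unitaryGroupOfForm (conjLocal L (IsCMField.complexConj L) v) (cmLocalForm L 3 v))) ≠ n * t * n⁻¹) →
              ν (Φ '' (A₀ ×ˢ V)) = (quotientMeasure T tm hTcl ν) A₀ * ∫⁻ t in V, (D t : ℝ≥0∞) ∂tm :=
  tubeJacobianLocal_cartan_of_cmTorus L v ν hTM hTcl Φ hΦ tm htm w hw DM D hDD (tubeJacobianSocket_vanDijkWeight_sq L v hns ν w hw DM hDM)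

/-! ## §2 On the organ carrier `Gqs L v` (the binder shape of ★ p851803 ∕ (E4)) -/

set_option maxHeartbeats 1600000 in
set_option synthInstance.maxHeartbeats 400000 in
-- long socket statements; the matrix-carrier instances are the organ's, passed by position (★ p851891 §2)
/-- **(J6) «CARTAN SLOT M» (organ carrier `Gqs L v`).**  The same with every binder on `Gqs L v` exactly as ★ p851803 ∕ (E4) read them — ★ p851891 §2 with `hJacLoc` := ★ FILE 6
(its generic instances instantiated at the organ's).  USE: the `hJac i` slot of (E4) `weylIntegrationFormula_of_pins_of_tubeJacobians` at the split Cartan `T i = M = Z(m₀)`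
(★ `exists_isRegularElt_centralizer_eq_cmTorus`), `hTcl := isClosed_cartan (hT i)`. [cite: HarishChandra1970, Lemma 20; Lemma 22] [cite: Rogawski1990, §12.5 p. 182; §3.6 p. 29] -/
theorem tubeJacobianLocal_cartan_Gqs_vanDijkWeight_sq
    (hns : ∀ w : PlacesOver L v, IsCMField.complexConj L • w.1 = w.1)
    [MeasurableSpace (Gqs L v)] [BorelSpace (Gqs L v)] [LocallyCompactSpace (Gqs L v)] [SecondCountableTopology (Gqs L v)] [T2Space (Gqs L v)]
    (ν : Measure (Gqs L v)) [ν.IsHaarMeasure] [ν.IsMulRightInvariant]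
    {T : Subgroup (Gqs L v)} (hTM : T = (cmBorelTriple L 3 v).M) (hTcl : IsClosed (T : Set (Gqs L v)))
    [MeasurableSpace (Gqs L v ⧸ T)] [BorelSpace (Gqs L v ⧸ T)]
    (Φ : (Gqs L v ⧸ T) × ↥T → Gqs L v) (hΦ : ∀ (x : Gqs L v) (t : ↥T), Φ (QuotientGroup.mk x, t) = x * t * x⁻¹)
    (tm : Measure ↥T) [tm.IsHaarMeasure] [tm.IsInvInvariant] (htm : tm (compactCore ↥T) = 1)
    (w : ↥(unitaryGroupOfForm (conjLocal L (IsCMField.complexConj L) v) (cmLocalForm L 3 v))) (hw : Units.val (w : GL (Fin 3) (LocalRing L v)) = cmLocalForm L 3 v)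
    (DM : ↥(cmBorelTriple L 3 v).M → ℝ≥0) (D : ↥T → ℝ≥0) (hDD : ∀ (t : ↥T) (t' : ↥(cmBorelTriple L 3 v).M), (t : Gqs L v) = (t' : ↥(unitaryGroupOfForm (conjLocal L (IsCMField.complexConj L) v) (cmLocalForm L 3 v))) → D t = DM t')
    (hDM : ∀ t : ↥(cmBorelTriple L 3 v).M, (DM t : ℝ) = ((F0P3cStCharTSTorusDefs.vanDijkWeight L v t).re) ^ 2) :
    ∀ t₀ : ↥T, IsRegularElt (((t₀ : Gqs L v)).val : GL (Fin 3) (LocalRing L v)) →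
      ∃ U : Set ↥T, IsOpen U ∧ t₀ ∈ U ∧
        ∃ A₀ : Set (Gqs L v ⧸ T), MeasurableSet A₀ ∧ (quotientMeasure T tm hTcl ν) A₀ ≠ 0 ∧
          (quotientMeasure T tm hTcl ν) A₀ ≠ ∞ ∧
          ∀ V : Set ↥T, MeasurableSet V → V ⊆ U → (∀ t ∈ V, IsRegularElt (((t : Gqs L v)).val : GL (Fin 3) (LocalRing L v))) →
            (∀ n : Gqs L v, n ∉ T → ∀ t ∈ V, ∀ t' ∈ V, ((t' : ↥T) : Gqs L v) ≠ n * t * n⁻¹) →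
              ν (Φ '' (A₀ ×ˢ V)) = (quotientMeasure T tm hTcl ν) A₀ * ∫⁻ t in V, (D t : ℝ≥0∞) ∂tm := by
  letI hmsU : MeasurableSpace ↥(unitaryGroupOfForm (conjLocal L (IsCMField.complexConj L) v) (cmLocalForm L 3 v)) := ‹MeasurableSpace (Gqs L v)›
  haveI hbU : BorelSpace ↥(unitaryGroupOfForm (conjLocal L (IsCMField.complexConj L) v) (cmLocalForm L 3 v)) := ⟨BorelSpace.measurable_eq (α := Gqs L v)⟩
  haveI hlcU : LocallyCompactSpace ↥(unitaryGroupOfForm (conjLocal L (IsCMField.complexConj L) v) (cmLocalForm L 3 v)) := ‹LocallyCompactSpace (Gqs L v)›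
  haveI hscU : SecondCountableTopology ↥(unitaryGroupOfForm (conjLocal L (IsCMField.complexConj L) v) (cmLocalForm L 3 v)) := ‹SecondCountableTopology (Gqs L v)›
  haveI ht2U : T2Space ↥(unitaryGroupOfForm (conjLocal L (IsCMField.complexConj L) v) (cmLocalForm L 3 v)) := ‹T2Space (Gqs L v)›
  haveI hHaarU : Measure.IsHaarMeasure (G := ↥(unitaryGroupOfForm (conjLocal L (IsCMField.complexConj L) v) (cmLocalForm L 3 v))) ν := ‹ν.IsHaarMeasure›
  haveI hRinvU : Measure.IsMulRightInvariant (G := ↥(unitaryGroupOfForm (conjLocal L (IsCMField.complexConj L) v) (cmLocalForm L 3 v))) ν := ‹ν.IsMulRightInvariant›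
  exact tubeJacobianLocal_cartan_Gqs_of_cmTorus L v ν hTM hTcl Φ hΦ tm htm w hw DM D hDD
    (@tubeJacobianSocket_vanDijkWeight_sq L _ _ _ v hns hmsU hbU hlcU hscU ht2U ν hHaarU hRinvU w hw DM hDM)

end Summit.HodgeConjecture.HodgeConjecture.Cruxes.H413.F0P3cStCharTSWeylHypJacobianCartanM

end
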